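import Literature.AlgebraicGeometry.Motives.MixedHodgeStructureEndomorphismAlgebra
import Mathlib.LinearAlgebra.Semisimple
import Mathlib.RingTheory.Polynomial.UniqueFactorization
import HarnessLib

/-!
# Endomorphisms of mixed Hodge structures: primary decomposition and minimal polynomials

For an endomorphism `a` of a mixed `ℚ`-Hodge structure `H` (an element of the finite-dimensional `ℚ`-algebra
`End_MHS(H) = H.endAlg`, `Motives/MixedHodgeStructureEndomorphismAlgebra`) every polynomial `p(a)`, `p ∈ ℚ[X]`, is
again an endomorphism of MHS, so the kernels `Ker p(a)` are sub-MHS (mixed Hodge structures form an abelian category,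
Cattani–El Zein–Griffiths–Lê Thm. 3.2.18). Hence the **Primary Decomposition Theorem** of linear algebra
(Gallier–Quaintance, Thm. 22.3: for the minimal polynomial `m = p₁^{r₁} ⋯ p_k^{r_k}` of `f`,
`E = Ker p₁^{r₁}(f) ⊕ ⋯ ⊕ Ker p_k^{r_k}(f)`; two coprime factors `m = g h` give `E = Ker g(f) ⊕ Ker h(f)`) decomposes
`H` AS A MIXED HODGE STRUCTURE. Combined with Fitting's lemma / the locality of `End_MHS(H)` for indecomposable `H`
(Lam, (19.17): every endomorphism of an indecomposable module of finite length is an automorphism or nilpotent; the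
tree's `IsIndecomposable.isUnit_or_isNilpotent`) and Schur's lemma for simple `H` ((3.6); the tree's
`IsSimple.isUnit_of_ne_zero`):

* §1 `p(a) ∈ End_MHS(H)` acts by `p(a)` (`endAlg.coe_aeval`); **coprime splitting**: if `g`, `h` are coprime and
  `(g h)(a) = 0` then `H = Ker g(a) ⊕ Ker h(a)` by sub-MHS (`isCompl_ker_aeval_of_isCoprime`).
* §2 **indecomposable `H`: the minimal polynomial of every endomorphism is a power of a monic irreducible
  polynomial** (`IsIndecomposable.exists_minpoly_eq_pow`: `p(a)` cannot be a unit for an irreducible factor `p` of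
  the minimal polynomial, so it is nilpotent); an endomorphism with a rational eigenvalue `c` has `a - c`
  nilpotent, so an endomorphism has at most one rational eigenvalue; a SEMISIMPLE (= diagonalisable over `ℚ̄`)
  endomorphism of an indecomposable `H` is `0` or an automorphism and has irreducible minimal polynomial.
* §3 **simple `H`: every endomorphism has irreducible minimal polynomial** (`End_MHS(H)` is a division algebra,
  `IsSimple.irreducible_minpoly`), and an endomorphism with a rational eigenvalue is a scalar.

All statements proved; no definitions, no named facts, no instances.

## References

* [GallierQuaintance2019] J. Gallier, J. Quaintance, Linear Algebra and Optimization with Applications to Machine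
  Learning, Vol. I (2019), Thm. 22.3 (Primary Decomposition Theorem) and §22.5 (held text
  `book:gallier2019-linear-algebra-optimization-with-applications-machine-learning`, p0512).
* [Lam2001FirstCourse] T. Y. Lam, A First Course in Noncommutative Rings, 2nd ed. (2001), (19.16) Fitting, Thm.
  (19.17) (p. 285), (3.6) Schur's Lemma.
* [CattaniElZeinGriffithsLe2014] E. Cattani et al. (eds.), Hodge Theory (2014), Thm. 3.2.18, p. 270.
-/

noncomputable section

namespace Literature.AlgebraicGeometry.Motives

namespace MixedHodgeStructure

open Module Polynomial

universe u

variable {V : Type u} [AddCommGroup V] [Module ℚ V] {H : MixedHodgeStructure V}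

/-! ### §1 Polynomials in an endomorphism; coprime splitting by sub-MHS -/

/-- `p(a) ∈ End_MHS(H)` acts on `V` as `p(a)`. [cite: CattaniElZeinGriffithsLe2014, Thm. 3.2.18] -/
theorem endAlg.coe_aeval (a : H.endAlg) (p : ℚ[X]) : ((aeval a p : H.endAlg) : Module.End ℚ V) = aeval (a : Module.End ℚ V) p :=
  aeval_subalgebra_coe p H.endAlg a

/-- `Ker p(a)` is (the `ℚ`-space underlying) a sub-MHS of `H`. [cite: CattaniElZeinGriffithsLe2014, Thm. 3.2.18] -/
theorem endAlg.ker_toHom_aeval_toSubmodule (a : H.endAlg) (p : ℚ[X]) :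
    (endAlg.toHom (aeval a p)).ker.toSubmodule = LinearMap.ker (aeval (a : Module.End ℚ V) p) := by
  rw [Hom.ker_toSubmodule, endAlg.toHom_toLinearMap, endAlg.coe_aeval]

/-- **Coprime splitting (Primary Decomposition Theorem, two factors): if `g` and `h` are coprime and `(g h)(a) = 0`
for an endomorphism `a` of the MHS `H`, then `H = Ker g(a) ⊕ Ker h(a)` with both summands sub-MHS.**
[cite: GallierQuaintance2019, Thm. 22.3 (Primary Decomposition Theorem)] [cite: CattaniElZeinGriffithsLe2014, Thm. 3.2.18] -/
theorem isCompl_ker_aeval_of_isCoprime (a : H.endAlg) {g h : ℚ[X]} (hgh : IsCoprime g h) (h0 : aeval a (g * h) = 0) :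
    IsCompl (endAlg.toHom (aeval a g)).ker.toSubmodule (endAlg.toHom (aeval a h)).ker.toSubmodule := by
  rw [endAlg.ker_toHom_aeval_toSubmodule, endAlg.ker_toHom_aeval_toSubmodule]
  refine ⟨disjoint_ker_aeval_of_isCoprime _ hgh, codisjoint_iff.2 ?_⟩
  rw [sup_ker_aeval_eq_ker_aeval_mul_of_coprime _ hgh, ← endAlg.coe_aeval, h0]
  exact LinearMap.ker_zero

/-- In particular for the minimal polynomial: a coprime factorisation `minpoly a = g h` splits `H = Ker g(a) ⊕ Ker h(a)`
as an MHS. [cite: GallierQuaintance2019, Thm. 22.3 (Primary Decomposition Theorem)] [cite: CattaniElZeinGriffithsLe2014, Thm. 3.2.18] -/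
theorem isCompl_ker_aeval_of_minpoly_eq_mul (a : H.endAlg) {g h : ℚ[X]} (hgh : IsCoprime g h)
    (hm : minpoly ℚ a = g * h) :
    IsCompl (endAlg.toHom (aeval a g)).ker.toSubmodule (endAlg.toHom (aeval a h)).ker.toSubmodule :=
  isCompl_ker_aeval_of_isCoprime a hgh (by rw [← hm, minpoly.aeval])

/-! ### §2 Indecomposable mixed Hodge structures: prime-power minimal polynomials -/

variable [FiniteDimensional ℚ V]

omit [FiniteDimensional ℚ V] in
/-- **For an indecomposable `H`, a coprime splitting is trivial: `Ker g(a) = 0` or `Ker g(a) = H`** whenever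
`g`, `h` are coprime with `(g h)(a) = 0`. [cite: GallierQuaintance2019, Thm. 22.3 (Primary Decomposition Theorem)]
[cite: CattaniElZeinGriffithsLe2014, p. 270] -/
theorem IsIndecomposable.ker_aeval_eq_bot_or_eq_top (hH : H.IsIndecomposable) (a : H.endAlg) {g h : ℚ[X]}
    (hgh : IsCoprime g h) (h0 : aeval a (g * h) = 0) :
    LinearMap.ker (aeval (a : Module.End ℚ V) g) = ⊥ ∨ LinearMap.ker (aeval (a : Module.End ℚ V) g) = ⊤ := by
  have hc := isCompl_ker_aeval_of_isCoprime a hgh h0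
  rcases hH.eq_bot_or_eq_bot _ _ hc with h1 | h1
  · exact Or.inl (by rwa [endAlg.ker_toHom_aeval_toSubmodule] at h1)
  · refine Or.inr ?_
    have h2 := hc.sup_eq_top
    rwa [h1, sup_bot_eq, endAlg.ker_toHom_aeval_toSubmodule] at h2

/-- **For an indecomposable `H`, an irreducible factor `p` of the minimal polynomial of an endomorphism `a` has
`p(a)` nilpotent** (`p(a)` is an automorphism or nilpotent by Fitting / (19.17); a unit `p(a)` would make the
cofactor annihilate `a`, contradicting minimality). [cite: Lam2001FirstCourse, Thm. (19.17)]
[cite: GallierQuaintance2019, Thm. 22.3] -/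
theorem IsIndecomposable.isNilpotent_aeval_of_irreducible_dvd_minpoly (hH : H.IsIndecomposable) (a : H.endAlg)
    {p : ℚ[X]} (hp : Irreducible p) (hdvd : p ∣ minpoly ℚ a) : IsNilpotent (aeval a p) := by
  refine (hH.isUnit_or_isNilpotent (aeval a p)).resolve_left fun hu => ?_
  obtain ⟨q, hq⟩ := hdvd
  have hq0 : aeval a q = 0 := by
    have h := minpoly.aeval ℚ a
    rw [hq, map_mul] at h
    exact (hu.mul_right_eq_zero).1 h
  have hqne : q ≠ 0 := fun h0 => minpoly.ne_zero (Algebra.IsIntegral.isIntegral a) (by rw [hq, h0, mul_zero])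
  have hdeg := Polynomial.natDegree_le_natDegree (minpoly.degree_le_of_ne_zero ℚ a hqne hq0)
  rw [hq, natDegree_mul hp.ne_zero hqne] at hdeg
  have hp0 : 0 < p.natDegree := natDegree_pos_iff_degree_pos.2 (degree_pos_of_irreducible hp)
  omega

/-- **The minimal polynomial of an endomorphism of an indecomposable MHS is a power of a monic irreducible
polynomial** (only one primary component: `H = ⊕ Ker pᵢ^{rᵢ}(a)` as MHS). [cite: GallierQuaintance2019, Thm. 22.3 (Primary Decomposition Theorem)]
[cite: Lam2001FirstCourse, Thm. (19.17)] -/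
theorem IsIndecomposable.exists_minpoly_eq_pow (hH : H.IsIndecomposable) (a : H.endAlg) :
    ∃ p : ℚ[X], p.Monic ∧ Irreducible p ∧ ∃ m : ℕ, 0 < m ∧ minpoly ℚ a = p ^ m := by
  haveI : Nontrivial H.endAlg := nontrivial_endAlg_iff.2 hH.nontrivial
  have hint : IsIntegral ℚ a := Algebra.IsIntegral.isIntegral a
  have hnu : ¬IsUnit (minpoly ℚ a) := fun hu =>
    minpoly.ne_one ℚ a ((minpoly.monic hint).eq_one_of_isUnit hu)
  obtain ⟨p, hpm, hpi, hpd⟩ := exists_monic_irreducible_factor _ hnu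
  obtain ⟨n, hn⟩ := hH.isNilpotent_aeval_of_irreducible_dvd_minpoly a hpi hpd
  have hdvd : minpoly ℚ a ∣ p ^ n := minpoly.dvd ℚ a (by rw [map_pow, hn])
  obtain ⟨m, -, hm⟩ := (dvd_prime_pow hpi.prime n).1 hdvd
  have heq : minpoly ℚ a = p ^ m := eq_of_monic_of_associated (minpoly.monic hint) (hpm.pow m) hm
  refine ⟨p, hpm, hpi, m, Nat.pos_of_ne_zero fun h0 => ?_, heq⟩
  rw [h0, pow_zero] at heq
  exact minpoly.ne_one ℚ a heq

/-- Underlying-linear-map form. [cite: GallierQuaintance2019, Thm. 22.3 (Primary Decomposition Theorem)] [cite: Lam2001FirstCourse, Thm. (19.17)] -/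
theorem IsIndecomposable.exists_minpoly_toLinearMap_eq_pow (hH : H.IsIndecomposable) (f : Hom H H) :
    ∃ p : ℚ[X], p.Monic ∧ Irreducible p ∧ ∃ m : ℕ, 0 < m ∧ minpoly ℚ f.toLinearMap = p ^ m := by
  have h := minpoly.algHom_eq H.endAlg.val Subtype.val_injective f.toEndAlg
  rw [Subalgebra.coe_val] at h
  rw [← Hom.coe_toEndAlg, h]
  exact hH.exists_minpoly_eq_pow f.toEndAlg

/-- **An endomorphism of an indecomposable MHS with a rational eigenvalue `c` has `a - c` nilpotent** (`a - c` is not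
injective, hence not an automorphism, hence nilpotent by Fitting). [cite: Lam2001FirstCourse, (19.16) and Thm. (19.17)]
[cite: GallierQuaintance2019, Thm. 22.4] -/
theorem IsIndecomposable.isNilpotent_sub_algebraMap_of_hasEigenvalue (hH : H.IsIndecomposable) (a : H.endAlg) {c : ℚ}
    (hc : Module.End.HasEigenvalue (a : Module.End ℚ V) c) : IsNilpotent (a - algebraMap ℚ H.endAlg c) := by
  refine hH.isNilpotent_of_not_isUnit _ fun hu => ?_
  have hb := (endAlg.isUnit_iff_bijective _).1 hu
  obtain ⟨v, hv⟩ := hc.exists_hasEigenvector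
  refine hv.2 (hb.1 ?_)
  rw [map_zero, Subalgebra.coe_sub, Subalgebra.coe_algebraMap, LinearMap.sub_apply, Module.algebraMap_end_apply,
    Module.End.mem_eigenspace_iff.1 hv.1, sub_self]

/-- **An endomorphism of an indecomposable MHS has at most one rational eigenvalue.** [cite: Lam2001FirstCourse, Thm. (19.17)]
[cite: GallierQuaintance2019, Thm. 22.4] -/
theorem IsIndecomposable.eigenvalue_unique (hH : H.IsIndecomposable) (a : H.endAlg) {c c' : ℚ}
    (hc : Module.End.HasEigenvalue (a : Module.End ℚ V) c) (hc' : Module.End.HasEigenvalue (a : Module.End ℚ V) c') :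
    c = c' := by
  haveI : Nontrivial H.endAlg := nontrivial_endAlg_iff.2 hH.nontrivial
  have h1 := hH.isNilpotent_sub_algebraMap_of_hasEigenvalue a hc
  have h2 := hH.isNilpotent_sub_algebraMap_of_hasEigenvalue a hc'
  have hcomm : Commute (a - algebraMap ℚ H.endAlg c') (a - algebraMap ℚ H.endAlg c) :=
    ((Commute.refl a).sub_right (Algebra.commute_algebraMap_right c a)).sub_left
      ((Algebra.commute_algebraMap_left c' a).sub_right (Algebra.commute_algebraMap_left c' _))
  have h3 : IsNilpotent (algebraMap ℚ H.endAlg (c - c')) := by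
    have h := hcomm.isNilpotent_sub h2 h1
    rwa [sub_sub_sub_cancel_left, ← map_sub] at h
  by_contra hne
  have hu : IsUnit (algebraMap ℚ H.endAlg (c - c')) := (IsUnit.mk0 _ (sub_ne_zero.2 hne)).map _
  obtain ⟨n, hn⟩ := h3
  have h01 := (hu.pow n)
  rw [hn, isUnit_zero_iff] at h01
  exact zero_ne_one h01

/-- **A semisimple endomorphism of an indecomposable MHS is `0` or an automorphism** (nilpotent and semisimple
forces `0`). [cite: Lam2001FirstCourse, Thm. (19.17)] [cite: GallierQuaintance2019, Thm. 22.2] -/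
theorem IsIndecomposable.isUnit_or_eq_zero_of_isSemisimple (hH : H.IsIndecomposable) (a : H.endAlg)
    (ha : (a : Module.End ℚ V).IsSemisimple) : IsUnit a ∨ a = 0 := by
  refine (hH.isUnit_or_isNilpotent a).imp_right fun hn => Subtype.ext ?_
  exact Module.End.eq_zero_of_isNilpotent_isSemisimple (hn.map H.endAlg.val) ha

/-- **A semisimple endomorphism of an indecomposable MHS has irreducible minimal polynomial** (a prime power which is
square-free). [cite: GallierQuaintance2019, Thm. 22.2 and Thm. 22.3] [cite: Lam2001FirstCourse, Thm. (19.17)] -/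
theorem IsIndecomposable.irreducible_minpoly_of_isSemisimple (hH : H.IsIndecomposable) (a : H.endAlg)
    (ha : (a : Module.End ℚ V).IsSemisimple) : Irreducible (minpoly ℚ a) := by
  obtain ⟨p, -, hpi, m, hm0, hm⟩ := hH.exists_minpoly_eq_pow a
  have hsq : Squarefree (minpoly ℚ a) := by
    rw [← minpoly.algHom_eq H.endAlg.val Subtype.val_injective a]
    exact ha.minpoly_squarefree
  rw [hm] at hsq ⊢
  rcases hsq.eq_zero_or_one_of_pow_of_not_isUnit hpi.not_isUnit with h | h
  · exact absurd h hm0.ne'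
  · rw [h, pow_one]
    exact hpi

/-- With a rational eigenvalue, a semisimple endomorphism of an indecomposable MHS is a scalar.
[cite: GallierQuaintance2019, Thm. 22.2] [cite: Lam2001FirstCourse, Thm. (19.17)] -/
theorem IsIndecomposable.eq_algebraMap_of_isSemisimple_of_hasEigenvalue (hH : H.IsIndecomposable) (a : H.endAlg)
    (ha : (a : Module.End ℚ V).IsSemisimple) {c : ℚ} (hc : Module.End.HasEigenvalue (a : Module.End ℚ V) c) :
    a = algebraMap ℚ H.endAlg c := by
  have hn := hH.isNilpotent_sub_algebraMap_of_hasEigenvalue a hc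
  have hs : ((a - algebraMap ℚ H.endAlg c : H.endAlg) : Module.End ℚ V).IsSemisimple := by
    rw [Subalgebra.coe_sub, Subalgebra.coe_algebraMap]
    exact (Module.End.isSemisimple_sub_algebraMap_iff).2 ha
  exact sub_eq_zero.1 (Subtype.ext (Module.End.eq_zero_of_isNilpotent_isSemisimple (hn.map H.endAlg.val) hs))

/-! ### §3 Simple mixed Hodge structures: irreducible minimal polynomials -/

/-- `End_MHS(S)` of a simple `S` has no zero divisors (a division algebra, Schur). [cite: Lam2001FirstCourse, (3.6) Schur's Lemma]
[cite: CattaniElZeinGriffithsLe2014, p. 270] -/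
theorem IsSimple.noZeroDivisors_endAlg (hH : H.IsSimple) : NoZeroDivisors H.endAlg := by
  refine ⟨fun {a b} hab => ?_⟩
  by_contra hne
  rw [not_or] at hne
  exact hne.2 ((hH.isUnit_of_ne_zero a hne.1).mul_right_eq_zero.1 hab)

/-- `End_MHS(S)` of a simple `S` is a domain. [cite: Lam2001FirstCourse, (3.6) Schur's Lemma] [cite: CattaniElZeinGriffithsLe2014, p. 270] -/
theorem IsSimple.isDomain_endAlg (hH : H.IsSimple) : IsDomain H.endAlg := by
  haveI := hH.noZeroDivisors_endAlg
  haveI : Nontrivial H.endAlg := nontrivial_endAlg_iff.2 hH.isIndecomposable.nontrivial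
  exact NoZeroDivisors.to_isDomain _

/-- **Every endomorphism of a simple MHS has irreducible minimal polynomial** (`ℚ[a] ⊆ End_MHS(S)` is a field).
[cite: Lam2001FirstCourse, (3.6) Schur's Lemma] [cite: GallierQuaintance2019, Thm. 22.3] -/
theorem IsSimple.irreducible_minpoly (hH : H.IsSimple) (a : H.endAlg) : Irreducible (minpoly ℚ a) := by
  haveI := hH.isDomain_endAlg
  exact minpoly.irreducible (Algebra.IsIntegral.isIntegral a)

/-- Underlying-linear-map form. [cite: Lam2001FirstCourse, (3.6) Schur's Lemma] [cite: GallierQuaintance2019, Thm. 22.3] -/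
theorem IsSimple.irreducible_minpoly_toLinearMap (hH : H.IsSimple) (f : Hom H H) :
    Irreducible (minpoly ℚ f.toLinearMap) := by
  have h := minpoly.algHom_eq H.endAlg.val Subtype.val_injective f.toEndAlg
  rw [Subalgebra.coe_val] at h
  rw [← Hom.coe_toEndAlg, h]
  exact hH.irreducible_minpoly f.toEndAlg

/-- **An endomorphism of a simple MHS with a rational eigenvalue is a scalar** (`a - c` is not injective, hence zero
by Schur). [cite: Lam2001FirstCourse, (3.6) Schur's Lemma] [cite: CattaniElZeinGriffithsLe2014, p. 270] -/
theorem IsSimple.eq_algebraMap_of_hasEigenvalue (hH : H.IsSimple) (a : H.endAlg) {c : ℚ}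
    (hc : Module.End.HasEigenvalue (a : Module.End ℚ V) c) : a = algebraMap ℚ H.endAlg c := by
  by_contra hne
  have hu := hH.isUnit_of_ne_zero _ (sub_ne_zero.2 hne)
  have hb := (endAlg.isUnit_iff_bijective _).1 hu
  obtain ⟨v, hv⟩ := hc.exists_hasEigenvector
  refine hv.2 (hb.1 ?_)
  rw [map_zero, Subalgebra.coe_sub, Subalgebra.coe_algebraMap, LinearMap.sub_apply, Module.algebraMap_end_apply,
    Module.End.mem_eigenspace_iff.1 hv.1, sub_self]

/-- The degree of the minimal polynomial of an endomorphism of a simple MHS divides... is at most `dim V` and the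
minimal polynomial has no rational root unless the endomorphism is a scalar. [cite: Lam2001FirstCourse, (3.6) Schur's Lemma]
[cite: GallierQuaintance2019, Thm. 22.3] -/
theorem IsSimple.not_isRoot_minpoly_of_ne_algebraMap (hH : H.IsSimple) (a : H.endAlg) {c : ℚ}
    (hne : a ≠ algebraMap ℚ H.endAlg c) : ¬(minpoly ℚ (a : Module.End ℚ V)).IsRoot c := fun hr =>
  hne (hH.eq_algebraMap_of_hasEigenvalue a (Module.End.hasEigenvalue_iff_isRoot.2 hr))

end MixedHodgeStructure

end Literature.AlgebraicGeometry.Motives
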